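import Mathlib
import Literature.Analysis.FluidPDE.SuitableWeak
import Summits.NavierStokesRegularity.NavierStokesRegularity.Theorems.EulerZoomLiouvillePowerGaugeEulerLiouvillePressureFloorKillTools
import Summits.NavierStokesRegularity.NavierStokesRegularity.Theorems.EulerZoomLiouvillePowerGaugeEulerLiouvilleIrrotational
import Summits.NavierStokesRegularity.NavierStokesRegularity.Theorems.EulerZoomLiouvillePowerGaugeEulerLiouvillePastSymmetric
import Summits.NavierStokesRegularity.NavierStokesRegularity.Theorems.EulerZoomLiouvillePowerGaugeEulerLiouvilleDSSEndpointSlices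
import HarnessLib

/-!
# Crux `EulerZoomLiouville.PowerGaugeEulerLiouville` (stmt-NavierStokesRegularity-19832), line `pressure-floor`, stub A3:
# THE DEFICIT KILL — a relative pressure floor `p ≥ −ε|u|²`, `ε < ρ/(1+ρ)`, forces triviality in the window `0 < ρ ≤ 1/2`

Route №10 `EulerZoomLiouville` (NavierStokesRegularity), crux E = Seregin's power-gauged ancient Euler class
`a^{2ρ}A(a) + a^{ρ}E(a) + a^{2ρ}D(a) ≤ c` on `(−∞,0) × ℝ³`.  Line `pressure-floor` (ideator ns-idea-11;
`Cruxes/PowerGaugeEulerLiouville/Lines/pressure_floor.lean`), registered stub `stub_deficitKill` (A3, load-bearing),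
proved here with its signature `Sig.stub_deficitKill` UNFOLDED in the tree's vocabulary (the line's private
abbreviations `InClass`, `WeightedVirial`, `IsNewtonianWeight`, `NewtonianBumpFamily`, `powerProfile`,
`PressureDeficit`, `VanishesAE` are `def`s of the Cruxes file; the statement of `deficitKill` below is their
`δ`-unfolding, so the skeleton fills the stub by `exact deficitKill`).  The two analytic inputs of the line — the
slicewise weighted virial identity `∫ D²Φ(u,u) + ∫ p ΔΦ = 0` for Newtonian weights (A1, `stub_weightedVirial`) and
the Newtonian bump family `Ψ_R` (A2, `stub_newtonianBumps`) — are HYPOTHESES of A3, exactly as registered.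

THE ARGUMENT (one page; [folklore] weighted-virial / Chae-type Liouville mechanism with a sign input).  Choose
`β ∈ [0,1) ∩ (1−2ρ, 1)` with interior pinching constant `m = (1−β)/(3−β) > ε⁺ = max(ε,0)`
(`Kill.exists_beta_deficit` of the tools file, possible iff `ε < ρ/(1+ρ)`).  For a.e. `t < 0` the slice `v = u(t)`, `q = p(t)` has:
the virial identity for every bump `Ψ_n` (`R = n+1`, countably many weights), the floor `q ≥ −ε|v|²` a.e., and
the `A`-gauge `∫_{B(a)} |v|² ≤ c a^γ`, `γ = 1−2ρ ∈ [0,1)`, for all `a > √(−t)` (the gauge is a genuine `sup` in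
`t`).  Split `ℝ³ = B̄_R ∪ B̄_Rᶜ` (`Kill.deficit_weighted_le`):
  `∫_{B̄_R} D²Ψ(v,v) ≥ m ∫_{B̄_R} w|v|²` (pinching), `∫_{B̄_Rᶜ} D²Ψ(v,v) ≥ −C R^{3−β} ∫_{|x|>R} |v|²/|x|³ ≥ −8Cc R^{γ−β}`
  (tidal bound + the dyadic tail `Kill.integrableOn_tail_and_le`), `∫_{B̄_R} qΔΨ = ∫_{B̄_R} q w ≥ −ε⁺∫_{B̄_R} w|v|²`,
  `∫_{B̄_Rᶜ} qΔΨ ≥ −ε⁺ ∫_{R<|x|<2R} ΔΨ|v|² ≥ −ε⁺ R^{−β} ∫_{B(2R)}|v|² ≥ −2ε⁺c R^{γ−β}` (`0 ≤ ΔΨ ≤ w ≤ R^{−β}` on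
  the layer, `ΔΨ = 0` beyond `2R`);
summing, `0 = ∫D²Ψ(v,v) + ∫qΔΨ ≥ (m − ε⁺)∫_{B̄_R} w|v|² − (8C + 2ε⁺) c R^{γ−β}`.  Since `γ < β` the right side tends
to `0` along `R = n+1`, so every ball carries zero weighted energy and `v = 0` a.e.
(`Kill.ae_eq_zero_of_weighted_closedBall_le`); zero slices for a.e. `t < 0` give `u = 0` a.e. on the slab
(`PastSymmetric.ae_eq_zero_of_gauge_of_pastSlicesZero`).  Only the `A`-gauge, the sign hypothesis and the two line
inputs are used (`E`, `D`, the local energy inequality are carried, idle).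

* `Kill.deficit_weighted_le` — the one-radius inequality `(m−ε)∫_{B̄_R} w|v|² ≤ (8C+2ε) c R^{γ−β}`;
* `Kill.deficit_slice_ae_eq_zero` — one slice: countably many bumps ⇒ `v = 0` a.e.;
* **`deficitKill`** — `Sig.stub_deficitKill`, unfolded.

WHAT THIS IS NOT: not NS, not the crux — the pressure-deficit STRATUM (D) of the crux class (MODEL lattice: 19832 is a
class of Euler-side strata of a hypothetical Type-II zoom limit, not NS regularity); landed `--supports` stmt-19832.
The dictionary «`ε = 0` is the zoom image of the Seregin–Šverák 2002 floor `p ≥ −g`» is docstring-only.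
[folklore; mechanism: Chae, arXiv:0811.4647 Thm 1.1–1.2 (convex-weight virial Liouville), here with a Newtonian
bump weight instead of a globally convex one]
-/

noncomputable section

-- flat `Theorems/<Route><Decl>…` files of one crux share the namespace of the crux (tree convention)
set_option linter.dupNamespace false

open MeasureTheory Set Filter Topology Metric Function
open scoped ENNReal NNReal Laplacian ContDiff

namespace Summit.NavierStokesRegularity.NavierStokesRegularity.Theorems.PowerGaugeEulerLiouville.PressureFloor

open Literature.Analysis Literature.Analysis.FunctionSpaces Literature.Analysis.FluidPDE

/-! ### One radius: the weighted energy inequality of the deficit stratum -/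

/-- **The one-radius inequality of the deficit kill.**  Slice data: an a.e.-strongly measurable field `v` with the
`A`-gauge `∫⁻_{B(a)} ‖v‖ₑ² ≤ c a^γ` for `a ≥ r₀` (`γ ≤ 1`), a pressure `q ≥ −ε|v|²` a.e. (`ε ≥ 0`), a weight
`0 < w ≤ 1` with `w ≤ R^{−β}` off `B_R`, and a smooth `Ψ` with `0 ≤ ΔΨ ≤ w`, `ΔΨ = w` on `B̄_R`, `ΔΨ = 0` off `B_{2R}`,
lower pinching `D²Ψ(x)(y,y) ≥ m w(x)|y|²` on `B̄_R`, tidal bound `|D²Ψ(x)(y,y)| ≤ C R^{3−β}|x|^{−3}|y|²` off `B_R`,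
for which `D²Ψ(v,v)` and `qΔΨ` are integrable with `∫ D²Ψ(v,v) + ∫ qΔΨ = 0`.  Then
`(m − ε) ∫_{B̄_R} w|v|² ≤ (8C + 2ε) c R^{γ−β}`.  [folklore] -/
theorem Kill.deficit_weighted_le
    {v : EuclideanSpace ℝ (Fin 3) → EuclideanSpace ℝ (Fin 3)} {q : EuclideanSpace ℝ (Fin 3) → ℝ}
    (hv : AEStronglyMeasurable v volume) {c γ r₀ : ℝ} (hc : 0 ≤ c) (hγ1 : γ ≤ 1) (hr₀ : 0 < r₀)
    (hA : ∀ a : ℝ, r₀ ≤ a →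
      ∫⁻ x in ball (0 : EuclideanSpace ℝ (Fin 3)) a, ‖v x‖ₑ ^ 2 ≤ ENNReal.ofReal (c * a ^ γ))
    {β ε m C R : ℝ} (hε0 : 0 ≤ ε) (hC : 0 ≤ C) (hR : r₀ ≤ R)
    (hdef : ∀ᵐ x ∂(volume : Measure (EuclideanSpace ℝ (Fin 3))), -ε * ‖v x‖ ^ 2 ≤ q x)
    {w : EuclideanSpace ℝ (Fin 3) → ℝ} (hw01 : ∀ x, 0 < w x ∧ w x ≤ 1) (hwm : AEStronglyMeasurable w volume)
    (hwR : ∀ x : EuclideanSpace ℝ (Fin 3), R ≤ ‖x‖ → w x ≤ R ^ (-β))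
    {Ψ : EuclideanSpace ℝ (Fin 3) → ℝ}
    (hΔ : ∀ x, 0 ≤ Δ Ψ x ∧ Δ Ψ x ≤ w x) (hΔin : ∀ x, ‖x‖ ≤ R → Δ Ψ x = w x)
    (hΔout : ∀ x : EuclideanSpace ℝ (Fin 3), 2 * R ≤ ‖x‖ → Δ Ψ x = 0)
    (hpinch : ∀ x : EuclideanSpace ℝ (Fin 3), ‖x‖ ≤ R → ∀ y : EuclideanSpace ℝ (Fin 3),
      m * w x * ‖y‖ ^ 2 ≤ fderiv ℝ (fderiv ℝ Ψ) x y y)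
    (htidal : ∀ x : EuclideanSpace ℝ (Fin 3), R ≤ ‖x‖ → ∀ y : EuclideanSpace ℝ (Fin 3),
      |fderiv ℝ (fderiv ℝ Ψ) x y y| ≤ C * R ^ (3 - β) / ‖x‖ ^ 3 * ‖y‖ ^ 2)
    (hFi : Integrable (fun x => fderiv ℝ (fderiv ℝ Ψ) x (v x) (v x)))
    (hGi : Integrable (fun x => q x * Δ Ψ x))
    (hsum : (∫ x, fderiv ℝ (fderiv ℝ Ψ) x (v x) (v x)) + ∫ x, q x * Δ Ψ x = 0) :
    (m - ε) * ∫ x in closedBall (0 : EuclideanSpace ℝ (Fin 3)) R, w x * ‖v x‖ ^ 2 ≤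
      (8 * C + 2 * ε) * c * R ^ (γ - β) := by
  set B : Set (EuclideanSpace ℝ (Fin 3)) := closedBall 0 R with hB
  set F : EuclideanSpace ℝ (Fin 3) → ℝ := fun x => fderiv ℝ (fderiv ℝ Ψ) x (v x) (v x) with hF
  set G : EuclideanSpace ℝ (Fin 3) → ℝ := fun x => q x * Δ Ψ x with hG
  have hRpos : 0 < R := lt_of_lt_of_le hr₀ hR
  have hBm : MeasurableSet B := measurableSet_closedBall
  -- `|v|²` is integrable on every ball, `w |v|²` on `B`
  have hvball : ∀ a : ℝ, IntegrableOn (fun x => ‖v x‖ ^ 2) (ball (0 : EuclideanSpace ℝ (Fin 3)) a) volume := by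
    intro a
    have h := Kill.integrableOn_sq_ball hv
      (lt_of_le_of_lt (hA (max a r₀) (le_max_right _ _)) ENNReal.ofReal_lt_top)
    exact h.mono_set (ball_subset_ball (le_max_left _ _))
  have hvB : IntegrableOn (fun x => ‖v x‖ ^ 2) B volume :=
    (hvball (R + 1)).mono_set (closedBall_subset_ball (by linarith))
  have hWB : IntegrableOn (fun x => w x * ‖v x‖ ^ 2) B volume :=
    Kill.integrableOn_weight_mul_sq hvB hwm fun x => by
      rw [abs_of_pos (hw01 x).1]; exact (hw01 x).2
  -- (1) interior Hessian: pinching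
  have h1 : m * ∫ x in B, w x * ‖v x‖ ^ 2 ≤ ∫ x in B, F x := by
    rw [← integral_const_mul]
    refine setIntegral_mono_on (hWB.const_mul m) hFi.integrableOn hBm fun x hx => ?_
    have hxR : ‖x‖ ≤ R := by rw [hB, mem_closedBall, dist_zero_right] at hx; exact hx
    calc m * (w x * ‖v x‖ ^ 2) = m * w x * ‖v x‖ ^ 2 := by ring
      _ ≤ F x := hpinch x hxR (v x)
  -- (2) exterior Hessian: tidal bound against the dyadic tail
  obtain ⟨hTi, hTle⟩ :=
    Kill.integrableOn_tail_and_le hv hc hγ1 hRpos (fun a ha => hA a (le_trans hR ha))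
  have h2 : -(C * R ^ (3 - β)) * ∫ x in Bᶜ, ‖v x‖ ^ 2 / ‖x‖ ^ 3 ≤ ∫ x in Bᶜ, F x := by
    rw [← integral_const_mul]
    refine setIntegral_mono_on (hTi.const_mul _) hFi.integrableOn hBm.compl fun x hx => ?_
    have hxR : R ≤ ‖x‖ := by
      rw [mem_compl_iff, hB, mem_closedBall, dist_zero_right, not_le] at hx; exact hx.le
    have h := (abs_le.1 (htidal x hxR (v x))).1
    calc -(C * R ^ (3 - β)) * (‖v x‖ ^ 2 / ‖x‖ ^ 3) = -(C * R ^ (3 - β) / ‖x‖ ^ 3 * ‖v x‖ ^ 2) := by ring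
      _ ≤ F x := h
  -- (3) interior pressure: the floor against `ΔΨ = w ≥ 0`
  have h3 : -ε * ∫ x in B, w x * ‖v x‖ ^ 2 ≤ ∫ x in B, G x := by
    rw [← integral_const_mul]
    refine setIntegral_mono_on_ae (hWB.const_mul _) hGi.integrableOn hBm ?_
    filter_upwards [hdef] with x hx hxB
    have hxR : ‖x‖ ≤ R := by rw [hB, mem_closedBall, dist_zero_right] at hxB; exact hxB
    show -ε * (w x * ‖v x‖ ^ 2) ≤ q x * Δ Ψ x
    rw [hΔin x hxR]
    calc -ε * (w x * ‖v x‖ ^ 2) = -ε * ‖v x‖ ^ 2 * w x := by ring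
      _ ≤ q x * w x := mul_le_mul_of_nonneg_right hx (hw01 x).1.le
  -- (4) exterior pressure: the layer `R < |x| < 2R`
  have h4 : -(ε * R ^ (-β)) * ∫ x in ball (0 : EuclideanSpace ℝ (Fin 3)) (2 * R), ‖v x‖ ^ 2 ≤
      ∫ x in Bᶜ, G x := by
    have hgi : Integrable ((ball (0 : EuclideanSpace ℝ (Fin 3)) (2 * R)).indicator fun x => ‖v x‖ ^ 2)
        volume := (hvball (2 * R)).integrable_indicator measurableSet_ball
    have hstep : ∫ x in Bᶜ, -(ε * R ^ (-β)) *
        (ball (0 : EuclideanSpace ℝ (Fin 3)) (2 * R)).indicator (fun x => ‖v x‖ ^ 2) x ≤ ∫ x in Bᶜ, G x := by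
      refine setIntegral_mono_on_ae (hgi.const_mul _).integrableOn hGi.integrableOn hBm.compl ?_
      filter_upwards [hdef] with x hx hxB
      have hxR : R ≤ ‖x‖ := by
        rw [mem_compl_iff, hB, mem_closedBall, dist_zero_right, not_le] at hxB; exact hxB.le
      show -(ε * R ^ (-β)) * (ball (0 : EuclideanSpace ℝ (Fin 3)) (2 * R)).indicator (fun x => ‖v x‖ ^ 2) x ≤
        q x * Δ Ψ x
      by_cases h2R : ‖x‖ < 2 * R
      · rw [indicator_of_mem (by rw [mem_ball, dist_zero_right]; exact h2R)]
        have hΔx := hΔ x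
        have hneg : -ε * ‖v x‖ ^ 2 ≤ 0 := by nlinarith [sq_nonneg ‖v x‖]
        calc -(ε * R ^ (-β)) * ‖v x‖ ^ 2 = -ε * ‖v x‖ ^ 2 * R ^ (-β) := by ring
          _ ≤ -ε * ‖v x‖ ^ 2 * Δ Ψ x := mul_le_mul_of_nonpos_left (le_trans hΔx.2 (hwR x hxR)) hneg
          _ ≤ q x * Δ Ψ x := mul_le_mul_of_nonneg_right hx hΔx.1
      · rw [indicator_of_notMem (by rw [mem_ball, dist_zero_right]; exact h2R), mul_zero,
          hΔout x (not_lt.1 h2R), mul_zero]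
    refine le_trans ?_ hstep
    rw [integral_const_mul, setIntegral_indicator measurableSet_ball]
    have hnp : -(ε * R ^ (-β)) ≤ 0 := by
      have : 0 ≤ ε * R ^ (-β) := mul_nonneg hε0 (Real.rpow_nonneg hRpos.le _)
      linarith
    refine mul_le_mul_of_nonpos_left ?_ hnp
    exact setIntegral_mono_set (hvball (2 * R)) (Eventually.of_forall fun x => sq_nonneg _)
      inter_subset_right.eventuallyLE
  -- (5) the bounds on the two error terms
  have hE : ∫ x in ball (0 : EuclideanSpace ℝ (Fin 3)) (2 * R), ‖v x‖ ^ 2 ≤ c * (2 * R) ^ γ :=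
    Kill.integral_sq_ball_le hv (mul_nonneg hc (Real.rpow_nonneg (by linarith) _)) (hA (2 * R) (by linarith))
  have h2γ : (2 * R) ^ γ ≤ 2 * R ^ γ := by
    rw [Real.mul_rpow (by norm_num) hRpos.le]
    refine mul_le_mul_of_nonneg_right ?_ (Real.rpow_nonneg hRpos.le _)
    conv_rhs => rw [← Real.rpow_one 2]
    exact Real.rpow_le_rpow_of_exponent_le (by norm_num) hγ1
  have hp1 : R ^ (3 - β) * R ^ (γ - 3) = R ^ (γ - β) := by
    rw [← Real.rpow_add hRpos]; congr 1; ring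
  have hp2 : R ^ (-β) * R ^ γ = R ^ (γ - β) := by
    rw [← Real.rpow_add hRpos]; congr 1; ring
  have hCR : 0 ≤ C * R ^ (3 - β) := mul_nonneg hC (Real.rpow_nonneg hRpos.le _)
  have hεR : 0 ≤ ε * R ^ (-β) := mul_nonneg hε0 (Real.rpow_nonneg hRpos.le _)
  have hTbound : C * R ^ (3 - β) * ∫ x in Bᶜ, ‖v x‖ ^ 2 / ‖x‖ ^ 3 ≤ 8 * C * c * R ^ (γ - β) := by
    calc C * R ^ (3 - β) * ∫ x in Bᶜ, ‖v x‖ ^ 2 / ‖x‖ ^ 3 ≤ C * R ^ (3 - β) * (8 * c * R ^ (γ - 3)) :=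
          mul_le_mul_of_nonneg_left hTle hCR
      _ = 8 * C * c * (R ^ (3 - β) * R ^ (γ - 3)) := by ring
      _ = 8 * C * c * R ^ (γ - β) := by rw [hp1]
  have hEbound : ε * R ^ (-β) * ∫ x in ball (0 : EuclideanSpace ℝ (Fin 3)) (2 * R), ‖v x‖ ^ 2 ≤
      2 * ε * c * R ^ (γ - β) := by
    calc ε * R ^ (-β) * ∫ x in ball (0 : EuclideanSpace ℝ (Fin 3)) (2 * R), ‖v x‖ ^ 2
          ≤ ε * R ^ (-β) * (c * (2 * R) ^ γ) := mul_le_mul_of_nonneg_left hE hεR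
      _ ≤ ε * R ^ (-β) * (c * (2 * R ^ γ)) :=
          mul_le_mul_of_nonneg_left (mul_le_mul_of_nonneg_left h2γ hc) hεR
      _ = 2 * ε * c * (R ^ (-β) * R ^ γ) := by ring
      _ = 2 * ε * c * R ^ (γ - β) := by rw [hp2]
  -- (6) sum up
  have hsF : (∫ x in B, F x) + (∫ x in Bᶜ, F x) = ∫ x, F x := integral_add_compl hBm hFi
  have hsG : (∫ x in B, G x) + (∫ x in Bᶜ, G x) = ∫ x, G x := integral_add_compl hBm hGi
  have hsum' : (∫ x, F x) + ∫ x, G x = 0 := hsum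
  have key : (m - ε) * (∫ x in B, w x * ‖v x‖ ^ 2) ≤
      C * R ^ (3 - β) * (∫ x in Bᶜ, ‖v x‖ ^ 2 / ‖x‖ ^ 3) +
        ε * R ^ (-β) * (∫ x in ball (0 : EuclideanSpace ℝ (Fin 3)) (2 * R), ‖v x‖ ^ 2) := by
    linarith [h1, h2, h3, h4, hsF, hsG, hsum']
  linarith [key, hTbound, hEbound]

/-! ### One slice: countably many bumps force `v = 0` -/

/-- **One slice of the deficit kill.**  With the data of `Kill.deficit_weighted_le` available for the bump of every
radius `R = n + 1`, `n ∈ ℕ` (one weight `w`, one tidal constant `C`, pinching constant `m > ε ≥ 0`, `γ < β`), the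
slice vanishes a.e.: `∫_{B̄_{n+1}} w|v|² ≤ (8C+2ε)c/(m−ε) · (n+1)^{γ−β} → 0`. [folklore] -/
theorem Kill.deficit_slice_ae_eq_zero
    {v : EuclideanSpace ℝ (Fin 3) → EuclideanSpace ℝ (Fin 3)} {q : EuclideanSpace ℝ (Fin 3) → ℝ}
    (hv : AEStronglyMeasurable v volume) {c γ r₀ : ℝ} (hc : 0 ≤ c) (hγ1 : γ ≤ 1) (hr₀ : 0 < r₀)
    (hA : ∀ a : ℝ, r₀ ≤ a →
      ∫⁻ x in ball (0 : EuclideanSpace ℝ (Fin 3)) a, ‖v x‖ₑ ^ 2 ≤ ENNReal.ofReal (c * a ^ γ))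
    {β ε m C : ℝ} (hγβ : γ < β) (hε0 : 0 ≤ ε) (hεm : ε < m) (hC : 0 ≤ C)
    (hdef : ∀ᵐ x ∂(volume : Measure (EuclideanSpace ℝ (Fin 3))), -ε * ‖v x‖ ^ 2 ≤ q x)
    {w : EuclideanSpace ℝ (Fin 3) → ℝ} (hw01 : ∀ x, 0 < w x ∧ w x ≤ 1) (hwm : AEStronglyMeasurable w volume)
    (hwR : ∀ R : ℝ, 0 < R → ∀ x : EuclideanSpace ℝ (Fin 3), R ≤ ‖x‖ → w x ≤ R ^ (-β))
    {Ψ : ℕ → EuclideanSpace ℝ (Fin 3) → ℝ}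
    (hΔ : ∀ n x, 0 ≤ Δ (Ψ n) x ∧ Δ (Ψ n) x ≤ w x)
    (hΔin : ∀ (n : ℕ) (x : EuclideanSpace ℝ (Fin 3)), ‖x‖ ≤ (n : ℝ) + 1 → Δ (Ψ n) x = w x)
    (hΔout : ∀ (n : ℕ) (x : EuclideanSpace ℝ (Fin 3)), 2 * ((n : ℝ) + 1) ≤ ‖x‖ → Δ (Ψ n) x = 0)
    (hpinch : ∀ (n : ℕ) (x : EuclideanSpace ℝ (Fin 3)), ‖x‖ ≤ (n : ℝ) + 1 →
      ∀ y : EuclideanSpace ℝ (Fin 3), m * w x * ‖y‖ ^ 2 ≤ fderiv ℝ (fderiv ℝ (Ψ n)) x y y)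
    (htidal : ∀ (n : ℕ) (x : EuclideanSpace ℝ (Fin 3)), (n : ℝ) + 1 ≤ ‖x‖ → ∀ y : EuclideanSpace ℝ (Fin 3),
      |fderiv ℝ (fderiv ℝ (Ψ n)) x y y| ≤ C * ((n : ℝ) + 1) ^ (3 - β) / ‖x‖ ^ 3 * ‖y‖ ^ 2)
    (hvir : ∀ n : ℕ, Integrable (fun x => fderiv ℝ (fderiv ℝ (Ψ n)) x (v x) (v x)) ∧
      Integrable (fun x => q x * Δ (Ψ n) x) ∧
      (∫ x, fderiv ℝ (fderiv ℝ (Ψ n)) x (v x) (v x)) + ∫ x, q x * Δ (Ψ n) x = 0) :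
    v =ᵐ[volume] 0 := by
  -- `w |v|²` is integrable on every closed ball
  have hvball : ∀ a : ℝ, IntegrableOn (fun x => ‖v x‖ ^ 2) (ball (0 : EuclideanSpace ℝ (Fin 3)) a) volume := by
    intro a
    have h := Kill.integrableOn_sq_ball hv
      (lt_of_le_of_lt (hA (max a r₀) (le_max_right _ _)) ENNReal.ofReal_lt_top)
    exact h.mono_set (ball_subset_ball (le_max_left _ _))
  have hint : ∀ n : ℕ, IntegrableOn (fun x => w x * ‖v x‖ ^ 2)
      (closedBall (0 : EuclideanSpace ℝ (Fin 3)) n) volume := fun n =>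
    Kill.integrableOn_weight_mul_sq ((hvball ((n : ℝ) + 1)).mono_set (closedBall_subset_ball (by linarith)))
      hwm fun x => by rw [abs_of_pos (hw01 x).1]; exact (hw01 x).2
  have hmε : 0 < m - ε := by linarith
  set K : ℝ := (8 * C + 2 * ε) * c / (m - ε) with hK
  -- the one-radius inequality at `R = n + 1`, for all large `n`
  have hle : ∀ᶠ n : ℕ in atTop,
      ∫ x in closedBall (0 : EuclideanSpace ℝ (Fin 3)) n, w x * ‖v x‖ ^ 2 ≤ K * ((n : ℝ) + 1) ^ (γ - β) := by
    obtain ⟨N, hN⟩ := exists_nat_ge r₀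
    filter_upwards [eventually_ge_atTop N] with n hn
    have hn' : (N : ℝ) ≤ n := by exact_mod_cast hn
    have hRn : r₀ ≤ (n : ℝ) + 1 := by linarith
    have hRpos : (0 : ℝ) < (n : ℝ) + 1 := by positivity
    obtain ⟨hFi, hGi, hsum⟩ := hvir n
    have key := Kill.deficit_weighted_le hv hc hγ1 hr₀ hA hε0 hC hRn hdef hw01 hwm (hwR _ hRpos) (hΔ n)
      (hΔin n) (hΔout n) (hpinch n) (htidal n) hFi hGi hsum
    have hmono : ∫ x in closedBall (0 : EuclideanSpace ℝ (Fin 3)) n, w x * ‖v x‖ ^ 2 ≤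
        ∫ x in closedBall (0 : EuclideanSpace ℝ (Fin 3)) ((n : ℝ) + 1), w x * ‖v x‖ ^ 2 :=
      setIntegral_mono_set
        (Kill.integrableOn_weight_mul_sq ((hvball ((n : ℝ) + 2)).mono_set (closedBall_subset_ball (by linarith)))
          hwm fun x => by rw [abs_of_pos (hw01 x).1]; exact (hw01 x).2)
        (Eventually.of_forall fun x => mul_nonneg (hw01 x).1.le (sq_nonneg _))
        (closedBall_subset_closedBall (by linarith)).eventuallyLE
    refine le_trans hmono ?_
    have h' := (le_div_iff₀' hmε).2 key
    calc ∫ x in closedBall (0 : EuclideanSpace ℝ (Fin 3)) ((n : ℝ) + 1), w x * ‖v x‖ ^ 2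
          ≤ (8 * C + 2 * ε) * c * ((n : ℝ) + 1) ^ (γ - β) / (m - ε) := h'
      _ = K * ((n : ℝ) + 1) ^ (γ - β) := by rw [hK]; ring
  -- the right side tends to zero
  have hb : Tendsto (fun n : ℕ => K * ((n : ℝ) + 1) ^ (γ - β)) atTop (𝓝 0) := by
    have h1 : Tendsto (fun n : ℕ => (n : ℝ) + 1) atTop atTop :=
      tendsto_atTop_add_const_right _ 1 tendsto_natCast_atTop_atTop
    have h2 : Tendsto (fun x : ℝ => x ^ (γ - β)) atTop (𝓝 0) := by
      have : γ - β = -(β - γ) := by ring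
      rw [this]
      exact tendsto_rpow_neg_atTop (by linarith)
    simpa using (h2.comp h1).const_mul K
  exact Kill.ae_eq_zero_of_weighted_closedBall_le (fun x => (hw01 x).1) hint hb hle

/-! ### The stub, unfolded -/

/-- **A3 `stub_deficitKill` of the line `pressure-floor` (signature `Sig.stub_deficitKill`, `δ`-unfolded): THE DEFICIT
KILL.**  In the window `0 < ρ ≤ 1/2`, a member `(u, p, H, c)` of Seregin's power-gauged ancient Euler class on
`(−∞,0) × ℝ³` that satisfies the slicewise weighted virial identity `∫ D²Φ(u,u) + ∫ p ΔΦ = 0` for every Newtonian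
weight `Φ` (line input A1), for which the Newtonian bump families exist at every exponent `β ∈ [0,1)` (line input A2,
pure real analysis), and whose pressure has a RELATIVE FLOOR `p ≥ −ε|u|²` a.e. with `ε < ρ/(1+ρ)`, vanishes a.e. on the
slab.  Proof: `Kill.exists_beta_deficit` (exponent), `Kill.deficit_weighted_le` (one radius), `Kill.deficit_slice_ae_eq_zero`
(one slice), `PastSymmetric.ae_eq_zero_of_gauge_of_pastSlicesZero` (slab).  `ε = 0` contains the zoom image `p ≥ 0` of
the Seregin–Šverák pressure floor (docstring-only dictionary).  WHAT THIS IS NOT: a stratum of the crux class, not NS.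
[folklore] -/
theorem deficitKill :
    ∀ ρ : ℝ, 0 < ρ → ρ ≤ 1 / 2 →
    ∀ (u : ℝ → EuclideanSpace ℝ (Fin 3) → EuclideanSpace ℝ (Fin 3)) (p : ℝ → EuclideanSpace ℝ (Fin 3) → ℝ)
      (H : ℝ → EuclideanSpace ℝ (Fin 3) → EuclideanSpace ℝ (Fin 3) →L[ℝ] EuclideanSpace ℝ (Fin 3)) (c : ℝ≥0),
      (IsSuitableWeakSolutionOn (slab (EuclideanSpace ℝ (Fin 3)) (Set.Iio 0) isOpen_Iio) 0 0 u p ∧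
        HasWeakSpatialGradientOn (slab (EuclideanSpace ℝ (Fin 3)) (Set.Iio 0) isOpen_Iio) u H ∧
        (∀ a : ℝ, 0 < a →
          ENNReal.ofReal (a ^ (2 * ρ)) * cknA a (0 : ℝ × EuclideanSpace ℝ (Fin 3)) u +
            ENNReal.ofReal (a ^ ρ) * cknE a (0 : ℝ × EuclideanSpace ℝ (Fin 3)) H +
            ENNReal.ofReal (a ^ (2 * ρ)) * cknD a (0 : ℝ × EuclideanSpace ℝ (Fin 3)) p ≤ (c : ℝ≥0∞))) →
      (∀ Φ : EuclideanSpace ℝ (Fin 3) → ℝ,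
        (ContDiff ℝ ∞ Φ ∧ ∃ K : ℝ, ∀ x : EuclideanSpace ℝ (Fin 3),
          |Φ x| ≤ K / (1 + ‖x‖) ∧ ‖fderiv ℝ Φ x‖ ≤ K / (1 + ‖x‖) ^ 2 ∧
            ∀ v : EuclideanSpace ℝ (Fin 3),
              |fderiv ℝ (fderiv ℝ Φ) x v v| ≤ K / (1 + ‖x‖) ^ 3 * ‖v‖ ^ 2) →
        ∀ᵐ t ∂(volume.restrict (Set.Iio (0 : ℝ))),
          Integrable (fun x : EuclideanSpace ℝ (Fin 3) => fderiv ℝ (fderiv ℝ Φ) x (u t x) (u t x)) ∧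
            Integrable (fun x : EuclideanSpace ℝ (Fin 3) => p t x * Δ Φ x) ∧
              (∫ x, fderiv ℝ (fderiv ℝ Φ) x (u t x) (u t x)) + ∫ x, p t x * Δ Φ x = 0) →
      (∀ β : ℝ, 0 ≤ β → β < 1 →
        ∃ C : ℝ, ∀ R : ℝ, 1 ≤ R → ∃ Ψ : EuclideanSpace ℝ (Fin 3) → ℝ,
          (ContDiff ℝ ∞ Ψ ∧ ∃ K : ℝ, ∀ x : EuclideanSpace ℝ (Fin 3),
            |Ψ x| ≤ K / (1 + ‖x‖) ∧ ‖fderiv ℝ Ψ x‖ ≤ K / (1 + ‖x‖) ^ 2 ∧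
              ∀ v : EuclideanSpace ℝ (Fin 3),
                |fderiv ℝ (fderiv ℝ Ψ) x v v| ≤ K / (1 + ‖x‖) ^ 3 * ‖v‖ ^ 2) ∧
          (∀ x : EuclideanSpace ℝ (Fin 3), 0 ≤ Δ Ψ x ∧ Δ Ψ x ≤ (1 + ‖x‖ ^ 2) ^ (-(β / 2))) ∧
          (∀ x : EuclideanSpace ℝ (Fin 3), ‖x‖ ≤ R → Δ Ψ x = (1 + ‖x‖ ^ 2) ^ (-(β / 2))) ∧
          (∀ x : EuclideanSpace ℝ (Fin 3), 2 * R ≤ ‖x‖ → Δ Ψ x = 0) ∧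
          (∀ x : EuclideanSpace ℝ (Fin 3), ‖x‖ ≤ R → ∀ v : EuclideanSpace ℝ (Fin 3),
              (1 - β) / (3 - β) * (1 + ‖x‖ ^ 2) ^ (-(β / 2)) * ‖v‖ ^ 2 ≤ fderiv ℝ (fderiv ℝ Ψ) x v v ∧
                fderiv ℝ (fderiv ℝ Ψ) x v v ≤ 1 / (3 - β) * (1 + ‖x‖ ^ 2) ^ (-(β / 2)) * ‖v‖ ^ 2) ∧
          (∀ x : EuclideanSpace ℝ (Fin 3), R ≤ ‖x‖ → ∀ v : EuclideanSpace ℝ (Fin 3),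
              |fderiv ℝ (fderiv ℝ Ψ) x v v| ≤ C * R ^ (3 - β) / ‖x‖ ^ 3 * ‖v‖ ^ 2)) →
      ∀ ε : ℝ, ε < ρ / (1 + ρ) →
        (∀ᵐ z ∂(volume.restrict (Set.Iio (0 : ℝ) ×ˢ (Set.univ : Set (EuclideanSpace ℝ (Fin 3))))),
          -ε * ‖u z.1 z.2‖ ^ 2 ≤ p z.1 z.2) →
        Function.uncurry u =ᵐ[volume.restrict (Set.Iio (0 : ℝ) ×ˢ (Set.univ : Set (EuclideanSpace ℝ (Fin 3))))]
          0 := by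
  intro ρ hρ hρ2 u p H c hcl hW hfam ε hε hdef
  obtain ⟨hsw, hH, hc⟩ := hcl
  -- the exponent, the pinching constant, the bump family
  obtain ⟨β, hβ0, hβ1, hβρ, hεm⟩ := Kill.exists_beta_deficit hρ hρ2 hε
  obtain ⟨C, hC⟩ := hfam β hβ0 hβ1
  have hR1 : ∀ n : ℕ, (1 : ℝ) ≤ (n : ℝ) + 1 := fun n => by
    have : (0 : ℝ) ≤ n := n.cast_nonneg
    linarith
  choose Ψ hΨ using fun n : ℕ => hC ((n : ℝ) + 1) (hR1 n)
  set m : ℝ := (1 - β) / (3 - β) with hm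
  set ε' : ℝ := max ε 0 with hε'
  set C' : ℝ := max C 0 with hC'
  have hm0 : 0 < m := div_pos (by linarith) (by linarith)
  have hε'0 : 0 ≤ ε' := le_max_right _ _
  have hε'm : ε' < m := max_lt hεm hm0
  have hC'0 : 0 ≤ C' := le_max_right _ _
  have hγ1 : 1 - 2 * ρ ≤ 1 := by linarith
  -- good slices: all virial identities, the floor, measurability
  have hvir : ∀ᵐ t ∂(volume.restrict (Iio (0 : ℝ))), ∀ n : ℕ,
      Integrable (fun x : EuclideanSpace ℝ (Fin 3) => fderiv ℝ (fderiv ℝ (Ψ n)) x (u t x) (u t x)) ∧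
        Integrable (fun x : EuclideanSpace ℝ (Fin 3) => p t x * Δ (Ψ n) x) ∧
          (∫ x, fderiv ℝ (fderiv ℝ (Ψ n)) x (u t x) (u t x)) + ∫ x, p t x * Δ (Ψ n) x = 0 :=
    ae_all_iff.2 fun n => hW (Ψ n) (hΨ n).1
  have hdef' := ae_ae_slice_of_ae_slab (P := fun t x => -ε * ‖u t x‖ ^ 2 ≤ p t x) hdef
  have hum : AEStronglyMeasurable (uncurry u)
      (volume.restrict (Iio (0 : ℝ) ×ˢ (univ : Set (EuclideanSpace ℝ (Fin 3))))) := by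
    have := hH.locallyIntegrableOn.aestronglyMeasurable
    simpa [slab] using this
  have hmeas : ∀ᵐ t ∂(volume.restrict (Iio (0 : ℝ))), t < 0 → AEStronglyMeasurable (u t) volume :=
    ae_restrict_of_ae (ae_slice_aestronglyMeasurable hum)
  have ht0 : ∀ᵐ t ∂(volume.restrict (Iio (0 : ℝ))), t ∈ Iio (0 : ℝ) := ae_restrict_mem measurableSet_Iio
  have hA := hasScaledLocalEnergyBound_of_gauge hc
  -- every good slice vanishes
  have hslice : ∀ᵐ t ∂(volume.restrict (Iio (0 : ℝ))), ∫⁻ x, ‖u t x‖ₑ ^ 2 = 0 := by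
    filter_upwards [hvir, hdef', hmeas, ht0] with t hvir hdef hmeas ht
    have ht' : t < 0 := ht
    have hv : AEStronglyMeasurable (u t) volume := hmeas ht'
    -- the `A`-gauge on this slice, for radii beyond `√(−t) + 1`
    have hAt : ∀ a : ℝ, Real.sqrt (-t) + 1 ≤ a →
        ∫⁻ x in ball (0 : EuclideanSpace ℝ (Fin 3)) a, ‖u t x‖ₑ ^ 2 ≤
          ENNReal.ofReal ((c : ℝ) * a ^ (1 - 2 * ρ)) := by
      intro a ha
      have hs0 : 0 ≤ Real.sqrt (-t) := Real.sqrt_nonneg _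
      have ha0 : 0 < a := by linarith
      refine hA a ha0 t ⟨?_, ht'⟩
      have h1 : Real.sqrt (-t) ^ 2 = -t := Real.sq_sqrt (by linarith)
      nlinarith
    have hdef2 : ∀ᵐ x ∂(volume : Measure (EuclideanSpace ℝ (Fin 3))), -ε' * ‖u t x‖ ^ 2 ≤ p t x := by
      filter_upwards [hdef] with x hx
      exact le_trans (mul_le_mul_of_nonneg_right (neg_le_neg (le_max_left ε 0)) (sq_nonneg _)) hx
    have htidal' : ∀ (n : ℕ) (x : EuclideanSpace ℝ (Fin 3)), (n : ℝ) + 1 ≤ ‖x‖ →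
        ∀ y : EuclideanSpace ℝ (Fin 3), |fderiv ℝ (fderiv ℝ (Ψ n)) x y y| ≤
          C' * ((n : ℝ) + 1) ^ (3 - β) / ‖x‖ ^ 3 * ‖y‖ ^ 2 := by
      intro n x hx y
      refine le_trans ((hΨ n).2.2.2.2.2 x hx y) ?_
      have hn0 : (0 : ℝ) ≤ (n : ℝ) + 1 := by linarith [hR1 n]
      exact mul_le_mul_of_nonneg_right (div_le_div_of_nonneg_right
        (mul_le_mul_of_nonneg_right (le_max_left C 0) (Real.rpow_nonneg hn0 _))
        (pow_nonneg (norm_nonneg _) 3)) (sq_nonneg _)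
    have hzero : u t =ᵐ[volume] 0 :=
      Kill.deficit_slice_ae_eq_zero hv c.coe_nonneg hγ1 (by positivity) hAt hβρ hε'0 hε'm hC'0 hdef2
        (w := fun x : EuclideanSpace ℝ (Fin 3) => (1 + ‖x‖ ^ 2) ^ (-(β / 2)))
        (fun x => Kill.powerProfile_pos_le_one hβ0 x) (Kill.continuous_powerProfile β).aestronglyMeasurable
        (fun R hR x hx => Kill.powerProfile_le_rpow_neg hβ0 hR hx)
        (Ψ := Ψ) (fun n => (hΨ n).2.1) (fun n => (hΨ n).2.2.1) (fun n => (hΨ n).2.2.2.1)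
        (fun n x hx y => ((hΨ n).2.2.2.2.1 x hx y).1) htidal' hvir
    calc ∫⁻ x, ‖u t x‖ₑ ^ 2 = ∫⁻ x, ‖(0 : EuclideanSpace ℝ (Fin 3) → EuclideanSpace ℝ (Fin 3)) x‖ₑ ^ 2 :=
          lintegral_congr_ae (by filter_upwards [hzero] with x hx; rw [hx])
      _ = 0 := by simp
  exact PastSymmetric.ae_eq_zero_of_gauge_of_pastSlicesZero hρ.le hsw hH hc (T₁ := 0) hslice

end Summit.NavierStokesRegularity.NavierStokesRegularity.Theorems.PowerGaugeEulerLiouville.PressureFloor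

end
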